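import Summits.ABC.IUTFork.Conditional.Layer1OfSb
import Summits.ABC.IUTFork.DAGXd
import HarnessLib

/-!
# L1 LAYER CERTIFICATE, part B — v2 (index RE-KEY swap): `Layer1DischargedB_v2` / `Layer1ConeB_v2`

abc-iut cell, director-abc (C2) «Conditional/Layer<k>OfS»; abc-iut-L1-lead R121 (5) «CERT-L1» (holder abc-iut-L1-d4 gen 5). Companion of
`Conditional/Layer1OfSb.lean` (v1, p429996 — kept verbatim as the record of v1; append-only rule «deprecate, don't mutate»): this file
carries the v2 declarations of part B in a separate module so that each certificate file stays ≤ 400 lines.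

WHY v2. The kernel-DAG index owner (abc-iut-c312-2, 2026-08-26T08:52:10Z) re-keyed [FrdI] Thm 5.1 (i)–(iv) as append-only primed
claim-form siblings in `DAGXd.lean` (p431849): `N_FrdI_Thm5_1_i'` (`_holds` = `thm51i_holds ∧ thm51i_bijection_holds ∧
thm51i_frobenius_holds`), `N_FrdI_Thm5_1_ii'`, `N_FrdI_Thm5_1_iii'`, `N_FrdI_Thm5_1_iv'`.  v1 conjoined the unprimed (i)/(iii), whose
`_holds` is a `Φ^birat`-membership lemma (abc-iut-f-038 F-f038-1), and merely LISTED the data aliases (ii)/(iv).  v2 swaps them.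
v2 COUNT LINE (part B): **92 = d 47 (v1's 45 with (i)/(iii) swapped to the primed siblings, + (ii)'/(iv)') + r 9 (unchanged:
`Layer1ResidualB` of v1, shared BY NAME) + d_data 35 (v1's 37 − the two Thm 5.1 data aliases) + refuted-as-typed 1 (Prop 4.4 (iii)).**
37 discharge sub-rows conjoined as in v1.  STATUS SOURCE plan/L1/NODES.md overlay #43; everything else as in v1's module docstring.

THIS FILE PROVES NOTHING NEW AND ASSERTS NOTHING: every conjunct is an index Prop BY NAME (universe-instantiated with the index's level
names) and every witness is the index's own `_holds` / `_part` term BY NAME.  HONEST FRAMING: typed ≠ proved; indexed ≠ endorsed;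
witnessed ≠ lead-discharged; nothing here asserts that abc is proved or refuted or takes a side on [IUTchIII] Cor. 3.12.
[claim: Mochizuki2012, status: disputed]
-/

namespace Summit.ABC.IUTFork.Conditional

open Summit.ABC.IUTFork.DAG

noncomputable section

universe u₁ u₂ u₃ u₄ u₅ u₆ u₇ u₈ u₉ u₁₀ u₁₁ u₁₂ u₁₃ u₁₄ u₁₅ u₁₆

/-- **L1 discharged, part B, v2** ([FrdI] §4–§6, [FrdII]): as v1 with [FrdI] Thm 5.1 (i)–(iv) through the re-keyed claim-form index Props,
BY NAME. [claim: Mochizuki2012, status: disputed] -/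
def Layer1DischargedB_v2 : Prop :=
  N_FrdI_Cor4_10.{u₁, u₂, u₃, u₄, u₅, u₆, u₇, u₈, u₉, u₁₀} -- FrdI:Cor4.10 · NODES=DISCHARGED · DAGL1s · `_holds`
  ∧ N_FrdI_Ex4_3 -- FrdI:Ex4.3 · NODES=DISCHARGED · DAGL1s · `_holds`
  ∧ N_FrdI_Ex6_3.{u₁} -- FrdI:Ex6.3 · NODES=DISCHARGED · DAGL1e · `_holds` (DAGUa)
  ∧ N_FrdI_Prop4_1_i.{u₁, u₂, u₃, u₄, u₅} -- FrdI:Prop4.1(i) · NODES=DISCHARGED · DAGL1z · `_holds`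
  ∧ N_FrdI_Prop4_1_ii.{u₁} -- FrdI:Prop4.1(ii) · NODES=DISCHARGED · DAGL1s · `_holds`
  ∧ N_FrdI_Prop4_1_iii.{u₁, u₂, u₃, u₄, u₅} -- FrdI:Prop4.1(iii) · NODES=DISCHARGED · DAGL1z · `_holds`
  ∧ N_FrdI_Prop4_1_iv.{u₁, u₂, u₃, u₄, u₅} -- FrdI:Prop4.1(iv) · NODES=DISCHARGED · DAGL1z · `_holds`
  ∧ N_FrdI_Prop4_1_v.{u₁, u₂, u₃, u₄, u₅} -- FrdI:Prop4.1(v) · NODES=DISCHARGED · DAGL1z · `_holds`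
  ∧ N_FrdI_Prop4_4_i.{u₁} -- FrdI:Prop4.4(i) · NODES=DISCHARGED · DAGL1d · `_holds` (DAGUa)
  ∧ N_FrdI_Prop4_4_ii.{u₁, u₂, u₃, u₄, u₅} -- FrdI:Prop4.4(ii) · NODES=DISCHARGED · DAGL1s · `_holds`
  ∧ N_FrdI_Prop4_4_iv.{u₁} -- FrdI:Prop4.4(iv) · NODES=DISCHARGED · DAGL1d · `_holds` (DAGUa)
  ∧ N_FrdI_Prop5_3.{u₁, u₂, u₃} -- FrdI:Prop5.3 · NODES=DISCHARGED · DAGL1t · `_holds` (DAGUa)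
  ∧ N_FrdI_Prop5_3_L02a.{u₁, u₂, u₃} -- sub-row of FrdI:Prop5.3 · DAGL1za · `_holds`
  ∧ N_FrdI_Thm5_1_i'.{u₁, u₂, u₃, u₄, u₅} -- FrdI:Thm5.1(i) · NODES=DISCHARGED · DAGXd (re-keyed sibling of N_FrdI_Thm5_1_i) · `_holds`
  ∧ N_FrdI_Thm5_1_ii'.{u₁, u₂, u₃, u₄, u₅} -- FrdI:Thm5.1(ii) · NODES=DISCHARGED · DAGXd (re-keyed claim-form sibling; v1 listed the data alias) · `_holds`
  ∧ N_FrdI_Thm5_1_iii'.{u₁, u₂, u₃, u₄, u₅} -- FrdI:Thm5.1(iii) · NODES=DISCHARGED · DAGXd (re-keyed sibling of N_FrdI_Thm5_1_iii) · `_holds`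
  ∧ N_FrdI_Thm5_1_iv'.{u₁, u₂, u₃, u₄, u₅} -- FrdI:Thm5.1(iv) · NODES=DISCHARGED · DAGXd (re-keyed claim-form sibling; v1 listed the data alias) · `_holds`
  ∧ N_FrdI_Thm5_2_i.{u₁, u₂, u₃} -- FrdI:Thm5.2(i) · NODES=DISCHARGED · DAGL1d · `_holds` (DAGUb)
  ∧ N_FrdI_Thm5_2_ii.{u₁, u₂, u₃} -- FrdI:Thm5.2(ii) · NODES=DISCHARGED · DAGL1s · `_holds`
  ∧ N_FrdI_Thm5_2_iv.{u₁, u₂, u₃, u₄, u₅} -- FrdI:Thm5.2(iv) · NODES=DISCHARGED · DAGL1t · `_holds`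
  ∧ N_FrdI_Thm6_2_i -- FrdI:Thm6.2(i) · NODES=DISCHARGED · DAGL1t · `_holds`
  ∧ N_FrdI_Thm6_2_i_L03 -- sub-row of FrdI:Thm6.2(i) · DAGL1y · `_holds`
  ∧ N_FrdI_Thm6_2_i_L05 -- sub-row of FrdI:Thm6.2(i) · DAGL1y · `_holds`
  ∧ N_FrdI_Thm6_2_ii -- FrdI:Thm6.2(ii) · NODES=DISCHARGED · DAGL1t · `_holds` (DAGUa)
  ∧ N_FrdI_Thm6_2_iii -- FrdI:Thm6.2(iii) · NODES=DISCHARGED-partial · DAGL1t · `_holds`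
  ∧ N_FrdI_Thm6_4_iv -- FrdI:Thm6.4(iv) · NODES=DISCHARGED-partial · DAGL1t · `_holds`
  ∧ N_FrdII_Ex1_1_i.{u₁} -- FrdII:Ex1.1(i) · NODES=DISCHARGED · DAGL1t · `_holds` (DAGUc)
  ∧ N_FrdII_Ex1_3_i.{u₁, u₂} -- FrdII:Ex1.3(i) · NODES=DISCHARGED · DAGL1e · `_holds` (DAGUc)
  ∧ N_FrdII_Ex1_3_ii.{u₁} -- FrdII:Ex1.3(ii) · NODES=DISCHARGED · DAGL1e · `_holds` (DAGUc)
  ∧ N_FrdII_Ex3_3_i -- FrdII:Ex3.3(i) · NODES=DISCHARGED · DAGL1v · `_holds` (DAGUa)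
  ∧ N_FrdII_Ex3_3_ii.{u₁, u₂} -- FrdII:Ex3.3(ii) · NODES=DISCHARGED · DAGL1v · `_holds`
  ∧ N_FrdII_Ex3_3_iii.{u₁, u₂, u₃, u₄, u₅} -- FrdII:Ex3.3(iii) · NODES=DISCHARGED · DAGL1v · `_holds` (DAGUa)
  ∧ N_FrdII_Ex3_3_iv -- FrdII:Ex3.3(iv) · NODES=DISCHARGED · DAGL1v · `_holds` (DAGUa)
  ∧ N_FrdII_Ex3_3_v -- FrdII:Ex3.3(v) · NODES=DISCHARGED · DAGL1v · `_holds` (DAGUa)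
  ∧ N_FrdII_Lem3_2_i -- FrdII:Lem3.2(i) · NODES=DISCHARGED · DAGL1u · `_holds`
  ∧ N_FrdII_Lem3_2_ii -- FrdII:Lem3.2(ii) · NODES=DISCHARGED · DAGL1u · `_holds`
  ∧ N_FrdII_Lem3_2_iii -- FrdII:Lem3.2(iii) · NODES=DISCHARGED · DAGL1u · `_holds`
  ∧ N_FrdII_Lem3_2_iv -- FrdII:Lem3.2(iv) · NODES=DISCHARGED · DAGL1u · `_holds`
  ∧ N_FrdII_Lem3_2_ix -- FrdII:Lem3.2(ix) · NODES=DISCHARGED · DAGL1v · `_holds`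
  ∧ N_FrdII_Lem3_2_v -- FrdII:Lem3.2(v) · NODES=DISCHARGED · DAGL1u · `_holds`
  ∧ N_FrdII_Lem3_2_vi -- FrdII:Lem3.2(vi) · NODES=DISCHARGED · DAGL1u · `_holds`
  ∧ N_FrdII_Lem3_2_viii -- FrdII:Lem3.2(viii) · NODES=DISCHARGED · DAGL1u · `_holds`
  ∧ N_FrdII_Lem3_2_x -- FrdII:Lem3.2(x) · NODES=DISCHARGED · DAGL1v · `_holds`
  ∧ N_FrdII_Lem3_2_xi -- FrdII:Lem3.2(xi) · NODES=DISCHARGED · DAGL1v · `_holds`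
  ∧ N_FrdII_Lem3_2_xii -- FrdII:Lem3.2(xii) · NODES=DISCHARGED · DAGL1v · `_holds`
  ∧ N_FrdII_Thm1_2_i.{u₁, u₂, u₃} -- FrdII:Thm1.2(i) · NODES=DISCHARGED · DAGL1t · `_holds`
  ∧ N_FrdII_Thm1_2_i_L01.{u₁, u₂} -- sub-row of FrdII:Thm1.2(i) · DAGL1y · `_holds`
  ∧ N_FrdII_Thm1_2_i_L02.{u₁, u₂} -- sub-row of FrdII:Thm1.2(i) · DAGL1y · `_holds`
  ∧ N_FrdII_Thm1_2_i_L03.{u₁, u₂} -- sub-row of FrdII:Thm1.2(i) · DAGL1y · `_holds`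
  ∧ N_FrdII_Thm1_2_i_L04.{u₁, u₂} -- sub-row of FrdII:Thm1.2(i) · DAGL1y · `_holds`
  ∧ N_FrdII_Thm1_2_i_L05.{u₁, u₂} -- sub-row of FrdII:Thm1.2(i) · DAGL1y · `_holds`
  ∧ N_FrdII_Thm1_2_i_L06.{u₁, u₂} -- sub-row of FrdII:Thm1.2(i) · DAGL1y · `_holds`
  ∧ N_FrdII_Thm1_2_i_L07.{u₁, u₂} -- sub-row of FrdII:Thm1.2(i) · DAGL1y · `_holds`
  ∧ N_FrdII_Thm1_2_i_L08.{u₁, u₂, u₃, u₄, u₅} -- sub-row of FrdII:Thm1.2(i) · DAGL1y · `_holds`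
  ∧ N_FrdII_Thm1_2_ii.{u₁, u₂, u₃} -- FrdII:Thm1.2(ii) · NODES=DISCHARGED · DAGL1t · `_holds`
  ∧ N_FrdII_Thm1_2_iii.{u₁, u₂, u₃} -- FrdII:Thm1.2(iii) · NODES=DISCHARGED · DAGL1t · `_holds`
  ∧ N_FrdII_Thm1_2_iv.{u₁, u₂} -- FrdII:Thm1.2(iv) · NODES=DISCHARGED · DAGL1t · `_holds`
  ∧ N_FrdII_Thm1_2_v.{u₁, u₂, u₃} -- FrdII:Thm1.2(v) · NODES=DISCHARGED · DAGL1t · `_holds`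
  ∧ N_FrdII_Thm1_2_v_L01.{u₁, u₂} -- sub-row of FrdII:Thm1.2(v) · DAGL1y · `_holds`
  ∧ N_FrdI_Cor4_11_i_L01.{u₁, u₂, u₃, u₄, u₅} -- sub-row of FrdI:Cor4.11(i) (node itself data-form/listed) · DAGL1x · `_holds`
  ∧ N_FrdI_Cor4_11_i_L04.{u₁, u₂, u₃, u₄, u₅, u₆, u₇, u₈, u₉, u₁₀} -- sub-row of FrdI:Cor4.11(i) (node itself data-form/listed) · DAGL1x · `_holds`
  ∧ N_FrdI_Cor4_11_i_L05.{u₁, u₂, u₃, u₄, u₅} -- sub-row of FrdI:Cor4.11(i) (node itself data-form/listed) · DAGL1x · `_holds`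
  ∧ N_FrdI_Cor4_11_i_L06.{u₁, u₂, u₃, u₄, u₅} -- sub-row of FrdI:Cor4.11(i) (node itself data-form/listed) · DAGL1x · `_holds`
  ∧ N_FrdI_Cor4_11_i_L07.{u₁, u₂, u₃, u₄, u₅} -- sub-row of FrdI:Cor4.11(i) (node itself data-form/listed) · DAGL1x · `_holds`
  ∧ N_FrdI_Cor4_11_ii_L08.{u₁, u₂, u₃, u₄, u₅, u₆, u₇, u₈, u₉, u₁₀} -- sub-row of FrdI:Cor4.11(ii) (node itself data-form/listed) · DAGL1x · `_holds`
  ∧ N_FrdI_Cor4_11_ii_L14.{u₁, u₂, u₃, u₄, u₅, u₆, u₇, u₈, u₉, u₁₀, u₁₁, u₁₂, u₁₃, u₁₄, u₁₅, u₁₆} -- sub-row of FrdI:Cor4.11(ii) (node itself data-form/listed) · DAGL1x · `_holds`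
  ∧ N_FrdI_Cor4_11_ii_L15.{u₁, u₂, u₃, u₄, u₅, u₆, u₇, u₈, u₉, u₁₀} -- sub-row of FrdI:Cor4.11(ii) (node itself data-form/listed) · DAGL1x · `_holds`
  ∧ N_FrdI_Cor4_11_ii_L17.{u₁, u₂, u₃, u₄, u₅} -- sub-row of FrdI:Cor4.11(ii) (node itself data-form/listed) · DAGL1x · `_holds`
  ∧ N_FrdI_Cor4_11_iii_L19.{u₁, u₂, u₃, u₄, u₅, u₆, u₇, u₈, u₉, u₁₀} -- sub-row of FrdI:Cor4.11(iii) (node itself data-form/listed) · DAGL1x · `_holds`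
  ∧ N_FrdI_Cor4_11_iii_L20.{u₁, u₂, u₃, u₄, u₅, u₆, u₇, u₈, u₉, u₁₀, u₁₁, u₁₂} -- sub-row of FrdI:Cor4.11(iii) (node itself data-form/listed) · DAGL1x · `_holds`
  ∧ N_FrdI_Thm4_2_i_T42_L02.{u₁, u₂, u₃, u₄, u₅, u₆, u₇, u₈, u₉, u₁₀} -- sub-row of FrdI:Thm4.2(i) (node itself data-form/listed) · DAGL1x · `_holds`
  ∧ N_FrdI_Thm4_2_i_T42_L04.{u₁, u₂, u₃, u₄, u₅, u₆, u₇, u₈, u₉, u₁₀} -- sub-row of FrdI:Thm4.2(i) (node itself data-form/listed) · DAGL1x · `_holds`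
  ∧ N_FrdI_Thm4_2_ii_T42_L08.{u₁, u₂, u₃, u₄, u₅, u₆, u₇, u₈, u₉, u₁₀} -- sub-row of FrdI:Thm4.2(ii) (node itself data-form/listed) · DAGL1x · `_holds`
  ∧ N_FrdI_Thm4_2_iii_T42_L12.{u₁, u₂, u₃, u₄, u₅, u₆, u₇, u₈, u₉, u₁₀} -- sub-row of FrdI:Thm4.2(iii) (node itself data-form/listed) · DAGL1x · `_holds`
  ∧ N_FrdI_Thm4_2_iii_T42_L13.{u₁, u₂} -- sub-row of FrdI:Thm4.2(iii) (node itself data-form/listed) · DAGL1y · `_holds`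
  ∧ N_FrdI_Thm6_4_i_L11.{u₁, u₂, u₃, u₄, u₅} -- sub-row of FrdI:Thm6.4(i) (node itself data-form/listed) · DAGL1y · `_holds`
  ∧ N_FrdII_Thm2_4_i_L04 -- sub-row of FrdII:Thm2.4(i) (node itself data-form/listed) · DAGL1y · `_holds`
  ∧ N_FrdII_Thm2_4_i_L05 -- sub-row of FrdII:Thm2.4(i) (node itself data-form/listed) · DAGL1y · `_holds`
  ∧ N_FrdII_Thm2_4_i_L07 -- sub-row of FrdII:Thm2.4(i) (node itself data-form/listed) · DAGL1y · `_holds`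
  ∧ N_FrdII_Thm2_4_i_L08 -- sub-row of FrdII:Thm2.4(i) (node itself data-form/listed) · DAGL1y · `_holds`
  ∧ N_FrdII_Thm2_4_i_L09.{u₁, u₂} -- sub-row of FrdII:Thm2.4(i) (node itself data-form/listed) · DAGL1y · `_holds`
  ∧ N_FrdII_Thm2_4_i_L11 -- sub-row of FrdII:Thm2.4(i) (node itself data-form/listed) · DAGL1y · `_holds`
  ∧ N_FrdII_Thm2_4_i_L12 -- sub-row of FrdII:Thm2.4(i) (node itself data-form/listed) · DAGL1y · `_holds`
  ∧ N_FrdII_Thm2_4_ii_L24 -- sub-row of FrdII:Thm2.4(ii) (node itself data-form/listed) · DAGL1y · `_holds`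

/-- `Layer1DischargedB_v2` holds: the index witnesses BY NAME (nothing new). [claim: Mochizuki2012, status: disputed] -/
theorem layer1DischargedB_v2_holds : Layer1DischargedB_v2.{u₁, u₂, u₃, u₄, u₅, u₆, u₇, u₈, u₉, u₁₀, u₁₁, u₁₂, u₁₃, u₁₄, u₁₅, u₁₆} :=
  ⟨N_FrdI_Cor4_10_holds,
    N_FrdI_Ex4_3_holds,
    N_FrdI_Ex6_3_holds,
    N_FrdI_Prop4_1_i_holds,
    N_FrdI_Prop4_1_ii_holds,
    N_FrdI_Prop4_1_iii_holds,
    N_FrdI_Prop4_1_iv_holds,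
    N_FrdI_Prop4_1_v_holds,
    N_FrdI_Prop4_4_i_holds,
    N_FrdI_Prop4_4_ii_holds,
    N_FrdI_Prop4_4_iv_holds,
    N_FrdI_Prop5_3_holds,
    N_FrdI_Prop5_3_L02a_holds,
    N_FrdI_Thm5_1_i'_holds,
    N_FrdI_Thm5_1_ii'_holds,
    N_FrdI_Thm5_1_iii'_holds,
    N_FrdI_Thm5_1_iv'_holds,
    N_FrdI_Thm5_2_i_holds,
    N_FrdI_Thm5_2_ii_holds,
    N_FrdI_Thm5_2_iv_holds,
    N_FrdI_Thm6_2_i_holds,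
    N_FrdI_Thm6_2_i_L03_holds,
    N_FrdI_Thm6_2_i_L05_holds,
    N_FrdI_Thm6_2_ii_holds,
    N_FrdI_Thm6_2_iii_holds,
    N_FrdI_Thm6_4_iv_holds,
    N_FrdII_Ex1_1_i_holds,
    N_FrdII_Ex1_3_i_holds,
    N_FrdII_Ex1_3_ii_holds,
    N_FrdII_Ex3_3_i_holds,
    N_FrdII_Ex3_3_ii_holds,
    N_FrdII_Ex3_3_iii_holds,
    N_FrdII_Ex3_3_iv_holds,
    N_FrdII_Ex3_3_v_holds,
    N_FrdII_Lem3_2_i_holds,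
    N_FrdII_Lem3_2_ii_holds,
    N_FrdII_Lem3_2_iii_holds,
    N_FrdII_Lem3_2_iv_holds,
    N_FrdII_Lem3_2_ix_holds,
    N_FrdII_Lem3_2_v_holds,
    N_FrdII_Lem3_2_vi_holds,
    N_FrdII_Lem3_2_viii_holds,
    N_FrdII_Lem3_2_x_holds,
    N_FrdII_Lem3_2_xi_holds,
    N_FrdII_Lem3_2_xii_holds,
    N_FrdII_Thm1_2_i_holds,
    N_FrdII_Thm1_2_i_L01_holds,
    N_FrdII_Thm1_2_i_L02_holds,
    N_FrdII_Thm1_2_i_L03_holds,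
    N_FrdII_Thm1_2_i_L04_holds,
    N_FrdII_Thm1_2_i_L05_holds,
    N_FrdII_Thm1_2_i_L06_holds,
    N_FrdII_Thm1_2_i_L07_holds,
    N_FrdII_Thm1_2_i_L08_holds,
    N_FrdII_Thm1_2_ii_holds,
    N_FrdII_Thm1_2_iii_holds,
    N_FrdII_Thm1_2_iv_holds,
    N_FrdII_Thm1_2_v_holds,
    N_FrdII_Thm1_2_v_L01_holds,
    N_FrdI_Cor4_11_i_L01_holds,
    N_FrdI_Cor4_11_i_L04_holds,
    N_FrdI_Cor4_11_i_L05_holds,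
    N_FrdI_Cor4_11_i_L06_holds,
    N_FrdI_Cor4_11_i_L07_holds,
    N_FrdI_Cor4_11_ii_L08_holds,
    N_FrdI_Cor4_11_ii_L14_holds,
    N_FrdI_Cor4_11_ii_L15_holds,
    N_FrdI_Cor4_11_ii_L17_holds,
    N_FrdI_Cor4_11_iii_L19_holds,
    N_FrdI_Cor4_11_iii_L20_holds,
    N_FrdI_Thm4_2_i_T42_L02_holds,
    N_FrdI_Thm4_2_i_T42_L04_holds,
    N_FrdI_Thm4_2_ii_T42_L08_holds,
    N_FrdI_Thm4_2_iii_T42_L12_holds,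
    N_FrdI_Thm4_2_iii_T42_L13_holds,
    N_FrdI_Thm6_4_i_L11_holds,
    N_FrdII_Thm2_4_i_L04_holds,
    N_FrdII_Thm2_4_i_L05_holds,
    N_FrdII_Thm2_4_i_L07_holds,
    N_FrdII_Thm2_4_i_L08_holds,
    N_FrdII_Thm2_4_i_L09_holds,
    N_FrdII_Thm2_4_i_L11_holds,
    N_FrdII_Thm2_4_i_L12_holds,
    N_FrdII_Thm2_4_ii_L24_holds⟩

/-- The [FrdI] §4–§6 + [FrdII] slice of the L1 cone, v2: discharged (v2) ∧ residual. [claim: Mochizuki2012, status: disputed] -/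
def Layer1ConeB_v2 : Prop :=
  Layer1DischargedB_v2.{u₁, u₂, u₃, u₄, u₅, u₆, u₇, u₈, u₉, u₁₀, u₁₁, u₁₂, u₁₃, u₁₄, u₁₅, u₁₆} ∧ Layer1ResidualB.{u₁, u₂}

/-- The v2 slice follows from its residual alone (the discharged half is witnessed BY NAME). [claim: Mochizuki2012, status: disputed] -/
theorem layer1ConeB_v2_of (h : Layer1ResidualB.{u₁, u₂}) : Layer1ConeB_v2.{u₁, u₂, u₃, u₄, u₅, u₆, u₇, u₈, u₉, u₁₀, u₁₁, u₁₂, u₁₃, u₁₄, u₁₅, u₁₆} :=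
  ⟨layer1DischargedB_v2_holds.{u₁, u₂, u₃, u₄, u₅, u₆, u₇, u₈, u₉, u₁₀, u₁₁, u₁₂, u₁₃, u₁₄, u₁₅, u₁₆}, h⟩

end

end Summit.ABC.IUTFork.Conditional
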